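import Summits.QuantumFields.BalabanUV.T4Continuum.Spine.NE1p.DressedTowerWitnessDiffuse

/-!
# T⁴ programme, spine estimate NE1′ (node O3b/H2) — A DIFFUSE FLUCTUATION MEASURE WITH A SMALL-FIELD INDICATOR BASE, part 2 of 3: the
# MEASURE-CLASS BINDERS DISCHARGED GENUINELY (non-atomicity, measurability, a.e. bounds, the three clauses of `RealBaseAt`, `hDμ` and
# `hpairx` through `ae_map_iff`), the booking convention, and the SEPARATION «not every function is integrable against the diffuse
# law» (crew `b2b-balaban-t4-ne1p-formalise-*`, leaf seat 07, generation 7; witness row W16 = N29q, BOOKED typer R-T65 (i); slots (γ)+(β))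

Cell `pub-balaban`, sub-cell `t4`, BINDER-OWNERS row NE1′.  ADDITIVE — imports part 1 `Spine/NE1p/DressedTowerWitnessDiffuse` ONLY (through
it W11r-1 `DressedTerminalWitnessReuse` p216180, S3l, W7, W5 and the Literature frame); modifies nothing.  Part 3 =
`Spine/NE1p/DressedTowerWitnessDiffuseEnd.lean` applies S3l's face BY NAME.

CONTENT.
* §4 NON-ATOMICITY (`segMeasure_singleton`: a non-zero bond ⟹ every singleton null; `μD_singleton`; contrast `flAt_zero_ne_zero`) and THE
  MEASURE-CLASS BINDERS of S3l `DressedStabilityOfCanonicalSliceWinSchedules.lean` on the NAMED affine functionals `FnD` against the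
  non-atomic law `μD k` with the indicator base `baseD k`: `hmeas` (l.237–238) := `aesm_FnD_translate` (BY MEASURABILITY in the product
  σ-algebra); `h𝒢` (l.215–218) := `FnD_translate_mem_bddClass` (measurability + an explicit a.e. bound on the fluctuation segment through
  `ae_mem_bondBall`); `hB` (l.219–222) := `realBaseAt_D` (ALL THREE clauses genuine: `0 ≤ᵐ 𝟙`, `μD k (support 𝟙) = 3∕2 > 0` by
  `Measure.map_apply` on the measurable small-field half-space, the base density integrable as a bounded measurable function on a finite
  law); `hE` (l.223–227) := `exponentSliceAt_D` (zero action, measurable for any law); `hDμ` (l.229) := `hDμD` and `hpairx` (l.231–235) :=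
  `relGauge_pairsD` — a.e. on a CONTINUUM of fluctuations, along the fluctuation itself with declared bound `δf_k`, through `ae_map_iff`
  on the measurable ball; the dictionary `hQ` as an EQUATION (`hQD`∕`hQTD`, W7's `𝒬M`∕W11r's `𝒬T` BY NAME) and the step law `hFnTD`.
* §5 births `hslD` (W7's bound `a_K·(c_M + 3)`), the booking convention `osc_leD`∕`osc_dirWD`∕`hsupD` (bounded, attained, `le_csSup`;
  `hne` is W11r's `hneM` BY NAME).
* §6 THE SEPARATION for the measure class: `not_integrable_inv_μD` — the measurable function `z ↦ (Re z₀₀)⁻¹` is NOT integrable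
  against `μD k` (its pull-back `t ↦ (δf_k·t)⁻¹` is not integrable across `0`, Mathlib `intervalIntegrable_inv_iff`), whereas against
  every two-atom law EVERY function is integrable (W5 `integrable_flAt`): for `μD` the class clauses are genuine obligations.

WHAT IT IS NOT (k2∕k3): a DECIDED TOY — NOT Bałaban's fluctuation measure, no numeral from print, not an estimate, no commutation identity,
F-6's rate a displayed wall; nothing of Bałaban's densities asserted; no `def … : Prop`; [folklore], 0 sorry, 0 citations used as facts.
Headline (c4): «the measure-class binders bite on a non-atomic law with a non-constant base; NE1′ ⇐ the named binders, NOT proved».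
HONEST FRAMING.  Rung (B)+1 bookkeeping on ONE finite four-torus — NOT infinite volume, NOT a mass gap, NOT OS on ℝ⁴, NOT Clay, NOT summit
progress; spine PROVED 0∕9.  HONEST DEPENDENCY: continuum YM on T⁴ ⇐ BetaPertH ∧ nine spine estimates (0/9 proved); BetaPertH ⇐ (D1) ∧
(D4) ∧ CAP+tail; G-an2-4 gates asym, D1 and NE2/3/4.
-/

noncomputable section

namespace Summit.QuantumFields.BalabanUV.T4Continuum.NE1p.DressedTowerWitnessDiffuse

open MeasureTheory Set Metric Filter Finset intervalIntegral
open scoped BigOperators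
open Literature.MathematicalPhysics.QuantumFieldTheory.Balaban1983to89
open Literature.MathematicalPhysics.QuantumFieldTheory.Balaban1983to89.T4TermFormat
open Literature.MathematicalPhysics.QuantumFieldTheory.Balaban1983to89.T4TermFormat.Booking
open T4TrajectoryModulus (bondBall)
open T4BlockTransport (Fld NDir latMove latN Site norm_dir_le)
open T4BirthChartTransport (GaugeInvariant BirthSlice RelGauge)
open T4TrajectoryDensity
open Summit.QuantumFields.BalabanUV.T4Continuum.T4TrajectoryDensityDressed
open Summit.QuantumFields.BalabanUV.T4Continuum.T4TrajectoryDensityWitness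
open Summit.QuantumFields.BalabanUV.T4Continuum.NE1p.DressedTowerWitness
open Summit.QuantumFields.BalabanUV.T4Continuum.NE1p.DressedTowerWitnessSlice
open Summit.QuantumFields.BalabanUV.T4Continuum.NE1p.DressedTerminalWitnessReuse

/-! ## §4 NON-ATOMICITY, and THE MEASURE-CLASS BINDERS GENUINELY: measurability, a.e. bounds, integrability against the non-atomic law [folklore] -/

/-- [folklore] The segment map of a field with a non-zero bond is injective. -/
theorem seg_injective {a : Fld 4 ℂ} {x : Site 4} {ν : Fin 4} (ha : a x ν ≠ 0) : Function.Injective (seg a) := by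
  intro t t' h
  have h' : (t : ℂ) * a x ν = (t' : ℂ) * a x ν := by
    simpa only [seg_apply] using congr_fun (congr_fun h x) ν
  exact_mod_cast mul_right_cancel₀ ha h'

/-- **NON-ATOMICITY** [folklore]: for a field with a non-zero bond, EVERY singleton is `segMeasure a`-null (its pre-image on the
parameter line is at most one point). -/
theorem segMeasure_singleton {a : Fld 4 ℂ} {x : Site 4} {ν : Fin 4} (ha : a x ν ≠ 0) (z : Fld 4 ℂ) :
    segMeasure a {z} = 0 := by
  unfold segMeasure
  rw [Measure.map_apply (measurable_seg a) (MeasurableSet.singleton z)]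
  have hsub : (seg a ⁻¹' {z}).Subsingleton := (subsingleton_singleton).preimage (seg_injective ha)
  exact hsub.finite.countable.measure_zero _


/-- [folklore] **The step law has no atoms.** -/
theorem μD_singleton (k : ℕ) (z : Fld 4 ℂ) : μD k {z} = 0 :=
  segMeasure_singleton (x := 0) (ν := 0) (by
    rw [show atomW (k + 1) 0 0 = ((dfW k : ℝ) : ℂ) from rfl]
    exact_mod_cast (dfW_pos k).ne') z


/-- [folklore] Total mass `2`. -/
theorem segMeasure_univ (a : Fld 4 ℂ) : segMeasure a univ = 2 := by
  unfold segMeasure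
  rw [Measure.map_apply (measurable_seg a) MeasurableSet.univ, preimage_univ, Measure.restrict_apply_univ, Real.volume_Icc]
  norm_num


/-- [folklore] CONTRAST: the two-atom law charges the reference atom — `(δ_0 + δ_a) {0} ≠ 0`. -/
theorem flAt_zero_ne_zero (a : Fld 4 ℂ) : flAt a {0} ≠ 0 := by
  unfold flAt
  rw [Measure.add_apply, Measure.dirac_apply_of_mem (mem_singleton _)]
  exact ne_of_gt (lt_of_lt_of_le one_pos le_self_add)


/-- THE DICTIONARY `hQ` AS AN EQUATION [folklore]: W7's exponent `𝒬M` IS `c₀ = ¼` times the fresh difference of the live generation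
`(b, 0)` of `FnD` at the pair `(U + z, U + 0)` (the increments of `FnD` and of W7's `FnM` coincide). -/
theorem hQD (K : ℕ) (b : (BM K).Birth) (k : ℕ) :
    (fun U z => 𝒬M K k U z - (fun (_ : Fld 4 ℂ) => (0 : ℂ)) U) =
      fun U z => ((1 / 4 : ℝ) : ℂ) * ∑ p ∈ ({(b, 0)} : Finset ((BM K).Birth × ℕ)),
        (FnD K p.2 k (U + z) - FnD K p.2 k (U + (fun (_ : (BM K).Birth) (_ : ℕ) => (0 : Fld 4 ℂ)) b k)) := by
  funext U z
  simp only [Finset.sum_singleton, FnD, ↓reduceIte, ev₀₀_add, add_zero, 𝒬M, sub_zero]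
  ring

/-- THE DICTIONARY AT EVERY STEP over W11r's cutoff-guarded `𝒬T`∕`SgM` [folklore]. -/
theorem hQTD (K : ℕ) (b : (BM K).Birth) (k : ℕ) :
    (fun U z => 𝒬T K k U z - (fun (_ : Fld 4 ℂ) => (0 : ℂ)) U) =
      fun U z => ((1 / 4 : ℝ) : ℂ) * ∑ p ∈ SgM K k b,
        (FnD K p.2 k (U + z) - FnD K p.2 k (U + (fun (_ : (BM K).Birth) (_ : ℕ) => (0 : Fld 4 ℂ)) b k)) := by
  by_cases hk : k ≤ K
  · rw [𝒬T_of_le hk, SgM_of_le hk]; exact hQD K b k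
  · rw [𝒬T_of_not_le hk, SgM_of_not_le hk]; funext U z; simp [zeroExp]

/-- THE STEP LAW below the cutoff [folklore]: `FnD_succ` (the guard `k + 1 ≤ K` puts `𝒬T K k = 𝒬M K k`). -/
theorem hFnTD (K k' k : ℕ) (hk : k + 1 ≤ K) (z₀ U : Fld 4 ℂ) :
    FnD K k' (k + 1) U = wOp (expWeight (baseD k) (zeroExp + 𝒬T K k)) (μD k) z₀ U (fun z => FnD K k' k (U + z)) := by
  rw [𝒬T_of_le (Nat.le_of_succ_le hk)]; exact FnD_succ K k' k z₀ U


/-- [folklore] **`hmeas`**: the translates of the carried functionals are a.e.-strongly measurable for the diffuse law — BECAUSE they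
are measurable (`measurable_FnD_translate`), not because the law is atomic. -/
theorem aesm_FnD_translate (K k' k j : ℕ) (U : Fld 4 ℂ) :
    AEStronglyMeasurable (fun z : Fld 4 ℂ => FnD K k' k (U + z)) (μD j) :=
  (measurable_FnD_translate K k' k U).aestronglyMeasurable

/-- [folklore] The a.e. bound of the translates on the step's fluctuation segment: `‖FnD (U + z)‖ ≤ a_K·(‖U₀₀‖ + δf_j + |shiftD k|)`. -/
theorem ae_norm_FnD_translate_le (K k' k j : ℕ) (U : Fld 4 ℂ) :
    ∀ᵐ z ∂μD j, ‖FnD K k' k (U + z)‖ ≤ aM K * (‖ev₀₀ U‖ + dfW j + |shiftD K k|) := by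
  have hatom : ∀ x ν, ‖atomW (j + 1) x ν‖ ≤ dfW j := fun x ν => by
    simp only [atomW, Complex.norm_real, Real.norm_eq_abs, dfW]
    rw [abs_of_nonneg (by have := psi_pos; positivity)]
  unfold μD
  filter_upwards [ae_mem_bondBall hatom] with z hz
  by_cases h : k' = 0
  · subst h
    simp only [FnD, ↓reduceIte, ev₀₀_add]
    rw [norm_mul, Complex.norm_real, Real.norm_eq_abs, abs_of_pos (aM_pos K)]
    refine mul_le_mul_of_nonneg_left ?_ (aM_pos K).le
    calc ‖ev₀₀ U + ev₀₀ z + (shiftD K k : ℂ)‖ ≤ ‖ev₀₀ U + ev₀₀ z‖ + ‖(shiftD K k : ℂ)‖ := norm_add_le _ _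
      _ ≤ ‖ev₀₀ U‖ + ‖ev₀₀ z‖ + ‖(shiftD K k : ℂ)‖ := by linarith [norm_add_le (ev₀₀ U) (ev₀₀ z)]
      _ ≤ ‖ev₀₀ U‖ + dfW j + |shiftD K k| := by
          have hz00 : ‖ev₀₀ z‖ ≤ dfW j := hz 0 0
          rw [Complex.norm_real, Real.norm_eq_abs]; linarith
  · simp only [FnD, h, ↓reduceIte, norm_zero]
    have := aM_pos K; have := dfW_pos j; positivity

/-- **`h𝒢` — THE TRANSLATES LIE IN THE INTEGRAND CLASS OF THE DIFFUSE LAW** [folklore]: a.e.-strongly measurable (by measurability in the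
product σ-algebra) AND essentially bounded (by the a.e. support on the fluctuation segment) — the two clauses of `BddClass` discharged
SEPARATELY and HONESTLY; contrast W5's `mem_bddClass_flAt`, which holds for EVERY function. -/
theorem FnD_translate_mem_bddClass (K k' k j : ℕ) (U : Fld 4 ℂ) :
    (fun z : Fld 4 ℂ => FnD K k' k (U + z)) ∈ BddClass ℂ (μD j) :=
  ⟨aesm_FnD_translate K k' k j U, _, ae_norm_FnD_translate_le K k' k j U⟩

/-- [folklore] The pre-image of the small-field set along the segment is the half-line `t ≤ ½`. -/
theorem seg_preimage_smallField (k : ℕ) :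
    seg (atomW (k + 1)) ⁻¹' {z : Fld 4 ℂ | (ev₀₀ z).re ≤ dfW k / 2} = Iic (1 / 2 : ℝ) := by
  ext t
  simp only [Set.mem_preimage, mem_setOf_eq, ev₀₀_seg_atomW, Complex.ofReal_re, Set.mem_Iic]
  have hd := dfW_pos k
  constructor
  · intro h
    by_contra hlt
    have hlt' : 1 / 2 < t := not_le.mp hlt
    nlinarith
  · intro h
    nlinarith

/-- **`hB` — THE REAL REGULAR REFERENCE WITH THE SMALL-FIELD INDICATOR BASE, AGAINST THE DIFFUSE LAW** [folklore] — all three clauses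
GENUINE: `0 ≤ᵐ base_k` (an indicator of a measurable set), **`0 < μD k (support base_k)`** — the support is the small-field half-space,
its pre-image on the parameter line is `[−1, ½]`, of Lebesgue length `3∕2` (S6b's interior-point clause with a PROPER sub-window) —, the
zero action exponent measurable and real, and the base density `𝟙·e^0` INTEGRABLE (bounded by `1`, measurable, finite law). -/
theorem realBaseAt_D (k : ℕ) (S : Set (Fld 4 ℂ)) : RealBaseAt (fun U : Fld 4 ℂ => U) (baseD k) zeroExp (μD k) S := by
  refine ⟨Eventually.of_forall fun z => baseD_nonneg k z, ?_, fun U₀ _ => ⟨aestronglyMeasurable_const, ?_, ?_⟩⟩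
  · have hsupp : Function.support (baseD k) = {z : Fld 4 ℂ | (ev₀₀ z).re ≤ dfW k / 2} := by
      unfold baseD
      rw [Set.support_indicator, Function.support_const one_ne_zero, Set.inter_univ]
    rw [hsupp]
    unfold μD segMeasure
    rw [Measure.map_apply (measurable_seg _) (measurableSet_smallField k), seg_preimage_smallField,
      Measure.restrict_apply measurableSet_Iic,
      show Iic (1 / 2 : ℝ) ∩ Icc (-1 : ℝ) 1 = Icc (-1 : ℝ) (1 / 2) from by
        ext t; simp only [mem_inter_iff, Set.mem_Iic, Set.mem_Icc]
        constructor
        · rintro ⟨h1, h2, _⟩; exact ⟨h2, h1⟩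
        · rintro ⟨h1, h2⟩; exact ⟨h2, h1, by linarith⟩,
      Real.volume_Icc]
    norm_num
  · exact Eventually.of_forall fun _ => by simp [zeroExp]
  · have hbd : baseDensity (baseD k) zeroExp U₀ = baseD k := by
      funext z; simp [baseDensity_apply, zeroExp]
    rw [hbd]
    refine Integrable.mono' (integrable_const (1 : ℝ)) (measurable_baseD k).aestronglyMeasurable
      (Eventually.of_forall fun z => ?_)
    rw [Real.norm_eq_abs, abs_of_nonneg (baseD_nonneg k z)]
    exact baseD_le_one k z

/-- **`hE` — THE EXPONENT SLICE AGAINST THE DIFFUSE LAW** [folklore]: the zero action exponent (DECLARED ≡ 0) is measurable for ANY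
law, holomorphic (constant) and of oscillation `0`. -/
theorem exponentSliceAt_D (j : ℕ) (S : Set (Fld 4 ℂ)) (w' ϱ : ℝ) :
    ExponentSliceAt (fun U : Fld 4 ℂ => U) zeroExp (μD j) latMove latN S w' ϱ 0 := fun _ _ _ _ _ =>
  ⟨univ, isOpen_univ, fun _ _ => subset_univ _, fun _ _ => aestronglyMeasurable_const,
    Eventually.of_forall fun _ => by simp only [zeroExp]; exact differentiableOn_const 0,
    Eventually.of_forall fun _ _ _ => by simp [zeroExp]⟩

/-- [folklore] W7's atom is bounded bond-wise by the step's fluctuation radius `σ k = ψ^{k+1}∕4` (indeed EQUAL to it). -/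
theorem norm_atomW_le_sigma (k : ℕ) (x : Site 4) (ν : Fin 4) : ‖atomW (k + 1) x ν‖ ≤ Wm.σ k := by
  rw [Wm_σ, pow_succ]
  simp only [atomW, Complex.norm_real, Real.norm_eq_abs]
  rw [abs_of_nonneg (by have := psi_pos; positivity), pow_succ]
  exact le_of_eq (by ring)

/-- **`hDμ` — A.E. SUPPORT IN THE FLUCTUATION BALL, through `ae_map_iff` on the measurable ball** [folklore]. -/
theorem hDμD (k : ℕ) : ∀ᵐ z ∂μD k, z ∈ (bondBall 4 (Wm.σ k) : Set (Fld 4 ℂ)) := by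
  unfold μD; exact ae_mem_bondBall (norm_atomW_le_sigma k)

/-- [folklore] W7's atom is bounded bond-wise by the fresh defect `δf_k`. -/
theorem norm_atomW_le_dfW (k : ℕ) (x : Site 4) (ν : Fin 4) : ‖atomW (k + 1) x ν‖ ≤ dfW k := by
  simp only [atomW, Complex.norm_real, Real.norm_eq_abs, dfW]
  rw [abs_of_nonneg (by have := psi_pos; positivity)]

/-- **`hpairx` A.E. AGAINST THE DIFFUSE LAW** [folklore]: for `μD k`-a.e. fluctuation `z` (i.e. a.e. on the SEGMENT `[−z_k, z_k]`, a
continuum of points) and EVERY base `Y`, the pair `(Y + 0, Y + z)` is in relative `Eq`-gauge with defect `δf_k` — along the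
direction `z` ITSELF with declared bound `δf_k` (admissible because a.e. `z ∈ bondBall δf_k`, by `ae_map_iff`). -/
theorem relGauge_pairsD (k : ℕ) :
    ∀ᵐ z ∂μD k, ∀ Y : Fld 4 ℂ, RelGauge (fun U U' : Fld 4 ℂ => U = U') latMove latN (Y + 0) (Y + z) (dfW k) := by
  unfold μD
  filter_upwards [ae_mem_bondBall (norm_atomW_le_dfW k)] with z hz
  intro Y
  refine ⟨fldDir z (dfW k) hz, dfW_pos k, le_rfl, ?_⟩
  show Y + z = latMove (Y + 0) (fldDir z (dfW k) hz) 1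
  rw [latMove_fldDir_one, add_zero]

/-! ## §5 The remaining function-level binders on the datum: births, the booking convention [folklore] -/

/-- `hsl` (w1): birth slices on the birth window `bondBall c_M`, bound `a_K·(c_M + 3)`; later generations `0` (W7's `hslM` verbatim on
`FnD`, `shiftD K 0 = 0`). [folklore] -/
theorem hslD (K : ℕ) (b : (BM K).Birth) (k' : ℕ) :
    BirthSlice (FnD K k' k') latMove latN (bondBall 4 (Wm.ρw k') : Set (Fld 4 ℂ)) 1 1 ((TM K).gen b k') := by
  intro U hU p hp hp1
  by_cases hk : k' = 0
  · subst hk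
    have hUc : ‖ev₀₀ U‖ ≤ cM := by rw [← Wm_ρw_zero]; exact hU 0 0
    refine ⟨ball 0 (3 / latN p), ?_, fun t ht => ?_, discs_subset_ball hp hp1 (by norm_num)⟩
    · simp only [FnD, ↓reduceIte, ev₀₀_latMove]; fun_prop
    · show ‖FnD K 0 0 (latMove U p t)‖ ≤ (if (0 : ℕ) = 0 then aM K * (cM + 3) else 0)
      simp only [FnD, ↓reduceIte, ev₀₀_latMove, shiftD, Complex.ofReal_zero, add_zero]
      have h3 := norm_t_mul_le p hp ht
      rw [norm_mul, Complex.norm_real, Real.norm_eq_abs, abs_of_pos (aM_pos K)]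
      calc aM K * ‖ev₀₀ U + t * ev₀₀ p.1.1‖ ≤ aM K * (‖ev₀₀ U‖ + ‖t * ev₀₀ p.1.1‖) :=
            mul_le_mul_of_nonneg_left (norm_add_le _ _) (aM_pos K).le
        _ ≤ aM K * (cM + 3) := mul_le_mul_of_nonneg_left (by linarith) (aM_pos K).le
  · refine ⟨univ, ?_, fun t _ => ?_, fun _ _ => subset_univ _⟩
    · simp only [FnD, if_neg hk]; fun_prop
    · show ‖FnD K k' k' (latMove U p t)‖ ≤ (if k' = 0 then aM K * (cM + 3) else 0)
      simp [FnD, hk]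

/-- **THE INCREMENT BOUND** [folklore]: an admissible pair of defect `δ_{k+1}` has increment `a_K·‖p₀₀‖ ≤ a_K·δ_{k+1} = lin b 0 k` (the
diffuse dressing cancels; later generations `0 ≤ 0`). -/
theorem osc_leD (K : ℕ) (b : (BM K).Birth) (k' k : ℕ) {U₀ U₁ : Fld 4 ℂ}
    (h : RelGauge (fun U U' : Fld 4 ℂ => U = U') latMove latN U₀ U₁ (defW (k + 1))) :
    ‖FnD K k' k U₁ - FnD K k' k U₀‖ ≤ (TM K).lin b k' k := by
  obtain ⟨p, hp, hpδ, rfl⟩ := h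
  show _ ≤ (if k' = 0 then aM K * defW (k + 1) else 0)
  by_cases hk : k' = 0
  · subst hk
    simp only [FnD, ↓reduceIte, ev₀₀_latMove, one_mul]
    rw [show (aM K : ℂ) * (ev₀₀ U₀ + ev₀₀ p.1.1 + (shiftD K k : ℂ)) - (aM K : ℂ) * (ev₀₀ U₀ + (shiftD K k : ℂ)) =
        (aM K : ℂ) * ev₀₀ p.1.1 by ring,
      norm_mul, Complex.norm_real, Real.norm_eq_abs, abs_of_pos (aM_pos K)]
    exact mul_le_mul_of_nonneg_left ((norm_dir_le p 0 0).trans hpδ) (aM_pos K).le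
  · simp [FnD, hk]

/-- **THE INCREMENT IS ATTAINED** along W5's `dirW (k+1)` from the base `0` [folklore]. -/
theorem osc_dirWD (K : ℕ) (b : (BM K).Birth) (k' k : ℕ) :
    ‖FnD K k' k (latMove 0 (dirW (k + 1)) 1) - FnD K k' k 0‖ = (TM K).lin b k' k := by
  show _ = (if k' = 0 then aM K * defW (k + 1) else 0)
  by_cases hk : k' = 0
  · subst hk
    simp only [↓reduceIte, FnD, ev₀₀_move_dirW, ev₀₀_zero, zero_add]
    rw [show (aM K : ℂ) * (((defW (k + 1) : ℝ) : ℂ) + (shiftD K k : ℂ)) - (aM K : ℂ) * (shiftD K k : ℂ) =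
        ((aM K * defW (k + 1) : ℝ) : ℂ) by push_cast; ring,
      Complex.norm_real, Real.norm_eq_abs, abs_of_pos (mul_pos (aM_pos K) (defW_pos (k + 1)))]
  · simp [FnD, hk]

/-- **`hsup` — THE BOOKED SIZE IS BELOW THE SUP OF THE REALISED INCREMENTS** (row S8's booking convention with `Real.sSup`) [folklore]:
bounded above (`osc_leD`) and attained (`osc_dirWD`), so `lin ≤ sSup` by `le_csSup`; `hne` is W11r's `hneM` BY NAME. -/
theorem hsupD (K : ℕ) (b : (BM K).Birth) (k' k : ℕ) :
    (TM K).lin b k' k ≤ sSup {x : ℝ | ∃ U₀ ∈ (bondBall 4 (Wm.ρw k) : Set (Fld 4 ℂ)), ∃ U₁ : Fld 4 ℂ,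
      RelGauge (fun U U' : Fld 4 ℂ => U = U') latMove latN U₀ U₁ (defW (k + 1)) ∧ x = ‖FnD K k' k U₁ - FnD K k' k U₀‖} := by
  refine le_csSup ⟨(TM K).lin b k' k, fun x hx => ?_⟩
    ⟨0, zero_mem_windowM k, latMove 0 (dirW (k + 1)) 1, ⟨dirW (k + 1), defW_pos (k + 1), le_rfl, rfl⟩, (osc_dirWD K b k' k).symm⟩
  obtain ⟨U₀, _, U₁, hrel, rfl⟩ := hx
  exact osc_leD K b k' k hrel

/-! ## §6 The SEPARATION for the measure class: not every function is integrable against the diffuse law [folklore] -/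

/-- **THE CLASS BINDER IS NOT VACUOUS FOR THE DIFFUSE LAW** [folklore]: the function `z ↦ (Re U₀₀ z)⁻¹` (measurable) is NOT integrable
against `μD k` — its pull-back along the segment is `t ↦ (δf_k·t)⁻¹`, not integrable across `0` (`intervalIntegrable_inv_iff`) —
whereas against the two-atom law `δ_0 + δ_{z_k}` EVERY function is integrable (W5 `integrable_flAt`).  So for `μD` the clauses of
`BddClass`∕`RealBaseAt`∕`hmeas` are genuine obligations, met above by measurability and a.e. bounds. -/
theorem not_integrable_inv_μD (k : ℕ) : ¬ Integrable (fun z : Fld 4 ℂ => ((ev₀₀ z).re)⁻¹) (μD k) := by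
  intro h
  have hmeas : AEStronglyMeasurable (fun z : Fld 4 ℂ => ((ev₀₀ z).re)⁻¹) (segMeasure (atomW (k + 1))) :=
    ((Complex.measurable_re.comp measurable_ev₀₀).inv).aestronglyMeasurable
  unfold μD segMeasure at h hmeas
  rw [integrable_map_measure hmeas (measurable_seg _).aemeasurable] at h
  have hcomp : (fun z : Fld 4 ℂ => ((ev₀₀ z).re)⁻¹) ∘ seg (atomW (k + 1)) = fun t : ℝ => (dfW k)⁻¹ * t⁻¹ := by
    funext t
    simp only [Function.comp_apply, ev₀₀_seg_atomW, Complex.ofReal_re, mul_inv, mul_comm]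
  rw [hcomp] at h
  have h' : IntegrableOn (fun t : ℝ => t⁻¹) (Icc (-1 : ℝ) 1) := by
    have := h.const_mul (dfW k)
    refine this.congr ?_
    filter_upwards with t
    rw [← mul_assoc, mul_inv_cancel₀ (dfW_pos k).ne', one_mul]
  have hint : IntervalIntegrable (fun t : ℝ => t⁻¹) volume (-1) 1 := by
    rw [intervalIntegrable_iff_integrableOn_Icc_of_le (by norm_num)]; exact h'
  have := intervalIntegrable_inv_iff.mp hint
  rcases this with h0 | h0
  · norm_num at h0
  · exact h0 (by rw [Set.uIcc_of_le (by norm_num)]; exact ⟨by norm_num, by norm_num⟩)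


end Summit.QuantumFields.BalabanUV.T4Continuum.NE1p.DressedTowerWitnessDiffuse

end
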